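import Summits.ResolutionOfSingularities.ResolutionOfSingularities.Theorems.PurelyInseparableDim4BandShade
import Summits.ResolutionOfSingularities.ResolutionOfSingularities.Theorems.PurelyInseparableDim4NarrowApolarity
import Literature.Algebra.Polynomial.JacobianCriterion
import Mathlib.Algebra.MvPolynomial.Division
import HarnessLib
import HarnessLib.Audit.Tags

/-!
# Purely inseparable four-folds — the TAME-CONE LETTERS: residual initial form `g = in(F)/x^r`, its
# VERTEX `Vtx(g)` (polar kernel), and the vertex algebra under shears (cell `res-dim4-pi`, K2(p) lane)

[OURS · counted 0 · cell `res-dim4-pi` · desk WORD #55 (a): FILE 1 of the typing of idea-4's CARD I-4-6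
(VT)/(E1-FREE); seat res-dim4-p-12 g2.]  Nothing here proves K2(p), `NoIsolatedTrap p p` or resolution of
singularities in dimension ≥ 4 / characteristic `p`.

On the isolated band (`p < ord₀ F ≤ 2p − 2`) the residual order `d = ord₀ F − |r|` never rises
(`…BandShade`, p664111) and K2(p) is the statement that no isolated chain keeps `d` constant for ever.
idea-4's CARD I-4-6 reads a finer letter there: the residual cone `g := in_d G`, `F = x^r · G`, and its
VERTEX `Vtx(g) = {v : g(y + v) ≡ g(y)}` — for `d < p` the kernel of the polar map `v ↦ Σ vᵢ ∂ᵢ g`.  This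
file fixes the two letters over the tree's vocabulary and proves the coordinate algebra the transform law
(FILE 2) and (VT)/(E1-FREE) (FILE 3) consume:

* §1 `resForm s := (initialForm s.F).divMonomial s.r` (= `in_d G` when `x^{s.r} ∣ s.F`:
  `monomial_mul_resForm`), `resVertex s := additiveSubspace (resForm s)` (the polar kernel
  `PointBlowup.additiveSubspace`, = idea-4's `Vtx` at `d < p`; `e_G := finrank (resVertex s)`).
* §2 shears and polars: `Hauser2010.shear j t` (`x_i ↦ x_i + t_i x_j`) composes additively and is
  injective (`shear_shear`, `shear_neg_shear`, `shear_eq_zero_iff`), and by the chain rule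
  (`Literature…pderiv_aeval`) **`pderiv j (shear j t Φ) = shear j t (D_v Φ)`** for the direction
  `v = e_j + t` (`pderiv_shear_self`); hence **`direction_mem_additiveSubspace_of_shear_free`**: if
  `shear j t Φ` does not involve `x_j` then `direction j t ∈ A(Φ)` — the algebraic core of (VT)(i)
  (a constant-`d` step makes the sheared residual cone `x_j`-free, FILE 2).
* §3 hyperplane sections of a subspace: `finrank_le_finrank_inf_hyperplane_add_one` and, when the
  subspace leaves the hyperplane `{w_j = 0}`, `finrank_inf_hyperplane_add_one` (rank–nullity for the
  coordinate functional) — the counting behind (VT)(iii) `dim(Vtx(g′) ∩ T E_new) ≤ e_G − 1`;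
  `single_mem_additiveSubspace_of_free` (`x_j`-free form ⇒ `e_j ∈ A`).
bears_on: LADDER-RESOLUTION:D157-DOOR2 (res-dim4-pi · K2(p) · I-4-6 letters).  Supports
stmt-ResolutionOfSingularities-16155 (helper).
-/

set_option linter.dupNamespace false -- mandated namespace of this single-conjunct summit

noncomputable section

namespace Summit.ResolutionOfSingularities.ResolutionOfSingularities.Theorems.PIDim4

namespace ResCone

open MvPolynomial Finset
open Literature.AlgebraicGeometry.Resolution
open Literature.AlgebraicGeometry.Resolution.CentreBlowup
open Literature.AlgebraicGeometry.Resolution.Hauser2010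
open Literature.AlgebraicGeometry.Resolution.HauserPerlega2019
open PointBlowup (polarMap additiveSubspace direction)

variable {K : Type} [Field K]

/-! ## 1. The letters -/

/-- **The residual cone** `g = in_d G` of a presented state `(F, r, exc)` with `F = x^r · G`: the initial
form of `F` divided by the boundary monomial `x^r` (idea-4's `in_d G`, CARD I-4-6). [folklore] -/
def resForm (s : State K) : MvPolynomial (Fin 4) K := (initialForm s.F).divMonomial s.r

/-- **The vertex of the residual cone**, as the kernel of its polar map `v ↦ Σ vᵢ ∂ᵢ g` (the tree's
`PointBlowup.additiveSubspace`; for `deg g < p` this is `{v : g(y + v) ≡ g(y)}`, idea-4's `Vtx(in_d G)`;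
`e_G = finrank (resVertex s)`). [folklore] -/
def resVertex (s : State K) : Submodule K (Fin 4 → K) := additiveSubspace (resForm s)

/-- Every monomial of the initial form is a monomial of `F`. [folklore] -/
theorem support_initialForm_subset (F : MvPolynomial (Fin 4) K) : (initialForm F).support ⊆ F.support := by
  intro d hd
  rw [MvPolynomial.mem_support_iff] at hd ⊢
  unfold initialForm at hd
  rw [coeff_homogeneousComponent] at hd
  by_contra h
  exact hd (by rw [h, ite_self])

/-- **`x^r · g = in(F)`** when `x^r ∣ F` monomialwise. [folklore] -/
theorem monomial_mul_resForm {s : State K} (hr : ∀ d ∈ s.F.support, s.r ≤ d) :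
    monomial s.r (1 : K) * resForm s = initialForm s.F := by
  classical
  unfold resForm
  ext m
  rw [coeff_monomial_mul']
  split_ifs with h
  · rw [one_mul, coeff_divMonomial, add_tsub_cancel_of_le h]
  · by_contra hne
    exact h (hr m (support_initialForm_subset _ (MvPolynomial.mem_support_iff.mpr (Ne.symm hne))))

/-- Coefficients of the residual cone: `coeff e g = coeff (r + e) in(F)`. [folklore] -/
theorem coeff_resForm (s : State K) (e : Fin 4 →₀ ℕ) :
    coeff e (resForm s) = coeff (s.r + e) (initialForm s.F) := rfl

/-- The weight-`1` weight of an exponent is its degree. [folklore] -/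
theorem weight_one_eq_degree (d : Fin 4 →₀ ℕ) : Finsupp.weight (1 : Fin 4 → ℕ) d = d.degree := by
  rw [Finsupp.degree_eq_weight_one]
  rfl

/-- The residual cone is homogeneous of degree `d = ord₀ F − |r|`. [folklore] -/
theorem resForm_isHomogeneous {s : State K} {o : ℕ} (ho : ordZero s.F = o) :
    (resForm s).IsHomogeneous (o - s.r.degree) := by
  intro e he
  rw [coeff_resForm] at he
  have hhom : (initialForm s.F).IsHomogeneous o := by
    unfold initialForm
    rw [ho]
    exact homogeneousComponent_isHomogeneous o s.F
  have h1 : Finsupp.weight (1 : Fin 4 → ℕ) (s.r + e) = o := hhom he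
  rw [weight_one_eq_degree, map_add] at h1
  rw [weight_one_eq_degree]
  omega

/-! ## 2. Shears and polars -/

/-- Composition of shears: `shear j s ∘ shear j t = shear j (t + s)` (for `t_j = 0`). [folklore] -/
theorem shear_shear (j : Fin 4) (s t : Fin 4 → K) (ht : t j = 0) (P : MvPolynomial (Fin 4) K) :
    shear j s (shear j t P) = shear j (t + s) P := by
  unfold shear
  rw [← AlgHom.comp_apply, comp_aeval]
  have hfun : (fun i => aeval (fun i => if i = j then (X j : MvPolynomial (Fin 4) K) else X i + C (s i) * X j)
      (if i = j then (X j : MvPolynomial (Fin 4) K) else X i + C (t i) * X j)) =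
      fun i => if i = j then (X j : MvPolynomial (Fin 4) K) else X i + C ((t + s) i) * X j := by
    funext i
    by_cases hij : i = j
    · subst hij; simp
    · simp only [if_neg hij, map_add, map_mul, aeval_X, aeval_C, if_true, Pi.add_apply,
        MvPolynomial.algebraMap_eq]
      ring
  rw [hfun]

/-- The trivial shear is the identity. [folklore] -/
theorem shear_zero (j : Fin 4) (P : MvPolynomial (Fin 4) K) : shear j 0 P = P := by
  unfold shear
  have : (fun i : Fin 4 => if i = j then (X j : MvPolynomial (Fin 4) K) else X i + C ((0 : Fin 4 → K) i) * X j)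
      = X := by
    funext i
    by_cases hij : i = j
    · subst hij; simp
    · simp [hij]
  rw [this, aeval_X_left, AlgHom.id_apply]

/-- **Shears are injective** (`shear j (−t)` undoes `shear j t`). [folklore] -/
theorem shear_neg_shear (j : Fin 4) {t : Fin 4 → K} (ht : t j = 0) (P : MvPolynomial (Fin 4) K) :
    shear j (-t) (shear j t P) = P := by
  rw [shear_shear j (-t) t ht, add_neg_cancel, shear_zero]

/-- `shear j t P = 0 ↔ P = 0`. [folklore] -/
theorem shear_eq_zero_iff (j : Fin 4) {t : Fin 4 → K} (ht : t j = 0) (P : MvPolynomial (Fin 4) K) :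
    shear j t P = 0 ↔ P = 0 := by
  refine ⟨fun h => ?_, fun h => by rw [h]; unfold shear; exact map_zero _⟩
  rw [← shear_neg_shear j ht P, h]
  unfold shear
  exact map_zero _

/-- **The `x_j`-derivative of a sheared form is the sheared polar along the direction `v = e_j + t`**
(chain rule; `t_j = 0`): `∂_j (shear j t Φ) = shear j t (D_v Φ)`. [cite: Humphreys1990, § 3.10 (chain rule)] -/
theorem pderiv_shear_self (j : Fin 4) {t : Fin 4 → K} (ht : t j = 0) (Φ : MvPolynomial (Fin 4) K) :
    pderiv j (shear j t Φ) = shear j t (polarMap Φ (direction j t)) := by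
  classical
  unfold shear
  rw [Literature.Algebra.Polynomial.JacobianCriterion.pderiv_aeval, NarrowApolarity.polarMap_apply, map_sum]
  refine Finset.sum_congr rfl fun i _ => ?_
  rw [map_smul, smul_eq_C_mul, mul_comm]
  congr 1
  unfold direction
  by_cases hij : i = j
  · subst hij
    rw [if_pos rfl, Function.update_self, pderiv_X, Pi.single_eq_same, C_1]
  · rw [if_neg hij, Function.update_of_ne hij, map_add, pderiv_C_mul, pderiv_X, pderiv_X,
      Pi.single_eq_of_ne hij, Pi.single_eq_same, mul_one, zero_add]

/-- A polynomial not involving `x_j` has `∂_j = 0`. [folklore] -/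
theorem pderiv_eq_zero_of_forall_apply_eq_zero {j : Fin 4} {Φ : MvPolynomial (Fin 4) K}
    (h : ∀ e ∈ Φ.support, e j = 0) : pderiv j Φ = 0 := by
  classical
  rw [Φ.as_sum, map_sum]
  refine Finset.sum_eq_zero fun e he => ?_
  rw [pderiv_monomial, h e he, Nat.cast_zero, mul_zero, monomial_zero]

/-- **THE ALGEBRAIC CORE OF (VT)(i)**: if the sheared form `shear j t Φ` (`t_j = 0`) does not involve the
variable `x_j`, then the direction `v = e_j + t` lies in the polar kernel `A(Φ)` — i.e. `Φ` is constant
along `v` to first order (`D_v Φ = 0`; for `deg Φ < p` this is `Φ(y + v) ≡ Φ(y)`, `v ∈ Vtx(Φ)`).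
[OURS] [folklore] -/
theorem direction_mem_additiveSubspace_of_shear_free (j : Fin 4) {t : Fin 4 → K} (ht : t j = 0)
    {Φ : MvPolynomial (Fin 4) K} (hfree : ∀ e ∈ (shear j t Φ).support, e j = 0) :
    direction j t ∈ additiveSubspace Φ := by
  unfold additiveSubspace
  rw [LinearMap.mem_ker, ← shear_eq_zero_iff j ht, ← pderiv_shear_self j ht]
  exact pderiv_eq_zero_of_forall_apply_eq_zero hfree

/-- An `x_j`-free form has `e_j` in its polar kernel. [folklore] -/
theorem single_mem_additiveSubspace_of_free {j : Fin 4} {Φ : MvPolynomial (Fin 4) K}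
    (h : ∀ e ∈ Φ.support, e j = 0) : (Pi.single j 1 : Fin 4 → K) ∈ additiveSubspace Φ := by
  classical
  unfold additiveSubspace
  rw [LinearMap.mem_ker, NarrowApolarity.polarMap_apply, Finset.sum_eq_single j (fun i _ hij => by
    rw [Pi.single_eq_of_ne hij, zero_smul]) (fun h => absurd (Finset.mem_univ j) h),
    Pi.single_eq_same, one_smul]
  exact pderiv_eq_zero_of_forall_apply_eq_zero h

/-! ## 3. Hyperplane sections of a subspace of `K⁴` -/

/-- The coordinate hyperplane `{w_j = 0}` (tangent space of the exceptional divisor `x_j = 0`). [folklore] -/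
def hyperplane (j : Fin 4) : Submodule K (Fin 4 → K) := LinearMap.ker (LinearMap.proj j)

/-- Membership in the coordinate hyperplane. [folklore] -/
theorem mem_hyperplane {j : Fin 4} {w : Fin 4 → K} : w ∈ hyperplane j ↔ w j = 0 := by
  unfold hyperplane
  rw [LinearMap.mem_ker, LinearMap.proj_apply]

/-- Rank–nullity for the coordinate functional on a subspace `A`:
`finrank A = finrank (A ⊓ {w_j = 0}) + finrank (range of w ↦ w_j on A)`. [folklore] -/
theorem finrank_eq_finrank_inf_hyperplane_add (A : Submodule K (Fin 4 → K)) (j : Fin 4) :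
    Module.finrank K A = Module.finrank K ↥(A ⊓ hyperplane j) +
      Module.finrank K (LinearMap.range ((LinearMap.proj j : (Fin 4 → K) →ₗ[K] K).domRestrict A)) := by
  set φ : A →ₗ[K] K := (LinearMap.proj j : (Fin 4 → K) →ₗ[K] K).domRestrict A with hφ
  have hrn := LinearMap.finrank_range_add_finrank_ker φ
  have hker : LinearMap.ker φ = Submodule.comap A.subtype (A ⊓ hyperplane j) := by
    ext x
    simp only [hφ, LinearMap.mem_ker, LinearMap.domRestrict_apply, Submodule.mem_comap,
      Submodule.coe_subtype, Submodule.mem_inf, mem_hyperplane, LinearMap.proj_apply]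
    exact ⟨fun h => ⟨x.2, h⟩, fun h => h.2⟩
  have hkereq : Module.finrank K (LinearMap.ker φ) = Module.finrank K ↥(A ⊓ hyperplane j) := by
    rw [hker]
    exact (Submodule.comapSubtypeEquivOfLe (inf_le_left : A ⊓ hyperplane j ≤ A)).finrank_eq
  omega

/-- **`dim A ≤ dim (A ∩ {w_j = 0}) + 1`** for every subspace `A ≤ K⁴`. [folklore] -/
theorem finrank_le_finrank_inf_hyperplane_add_one (A : Submodule K (Fin 4 → K)) (j : Fin 4) :
    Module.finrank K A ≤ Module.finrank K ↥(A ⊓ hyperplane j) + 1 := by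
  rw [finrank_eq_finrank_inf_hyperplane_add A j]
  have h : Module.finrank K (LinearMap.range ((LinearMap.proj j : (Fin 4 → K) →ₗ[K] K).domRestrict A)) ≤
      Module.finrank K K := Submodule.finrank_le _
  rw [Module.finrank_self] at h
  omega

/-- **`dim A = dim (A ∩ {w_j = 0}) + 1`** when `A` contains a vector with `u_j ≠ 0`. [folklore] -/
theorem finrank_inf_hyperplane_add_one (A : Submodule K (Fin 4 → K)) (j : Fin 4) {u : Fin 4 → K}
    (huA : u ∈ A) (huj : u j ≠ 0) :
    Module.finrank K ↥(A ⊓ hyperplane j) + 1 = Module.finrank K A := by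
  rw [finrank_eq_finrank_inf_hyperplane_add A j]
  congr 1
  have htop : LinearMap.range ((LinearMap.proj j : (Fin 4 → K) →ₗ[K] K).domRestrict A) = ⊤ := by
    rw [eq_top_iff]
    rintro c -
    refine ⟨(c / u j) • ⟨u, huA⟩, ?_⟩
    simp only [map_smul, LinearMap.domRestrict_apply, LinearMap.proj_apply, smul_eq_mul]
    exact div_mul_cancel₀ c huj
  rw [htop, finrank_top, Module.finrank_self]

end ResCone

end Summit.ResolutionOfSingularities.ResolutionOfSingularities.Theorems.PIDim4

end
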